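import Summits.QuantumFields.YangMills.Theorems.BalabanLadderNTMarkovMirrorAffine
import Summits.QuantumFields.YangMills.Theorems.BalabanLadderNTMarkovMirrorBareTypicalPackage
import HarnessLib

/-!
# Crux `UVSeamRec` (stmt-QuantumFields-20043), stub `stub_floorsEngine` (S-B) / crux `NT` clause (i):
# asymptotic packaging of the pinned-affine currency {RBL-aff-L², SF-aff} (method lane (M-aff))

Helper file (`--supports stmt-QuantumFields-20043`) of the seam stub-prover row `ym-20043-seam-s1` (owner RULING R87 (2)),
sequel of `…NTMarkovMirrorAffine` (per coupling and torus: `mirrorCov_ge_of_affineResponse_l2`) and of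
`…NTMarkovMirrorBareTypicalPackage` (the measure-typical clause-(i) package {MF, RBLΔ-L²}).  Along a unit map `a > 0`,
with ONE test function `v`, a positive-time cube family `Q_β = (c β, b β)` of physical size `≤ Λ₅`, and per coupling a
finite plaquette family `S β` based in the closed collar `[c β − 1, c β + b β]`, coefficients `g β`, constants
`g₀ β, p β`:

* (RBL-aff-L²) `∫ (kerE_{Q_β}^{lift U}(Ṽ_v) − p β + g₀ β + ∑_{b ∈ S β} g β b · plane_b(lift U))² dμ_T(U) ≤ ε/4` on every
  torus `aβ·L ≥ Λ₅` — the cube's conditional mean of the smeared density responds AFFINELY to the collar plaquette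
  fields, in mean square under Wilson's torus measure (`Ṽ_v = ∑_{y ∈ Q_β} v(aβ·y) dens_y`);
* (SF-aff)     `4ε ≤ ∑_{b, b' ∈ S β} g β b · g β b' · Cov_T(plane_b∘Θ₀, plane_{b'})` on every such torus — a floor on
  the response-weighted quadratic form of collar plaquette MIRROR covariances;

give the bare mirror floor (MF) `9ε/4 ≤ Cov_T(Ṽ_v∘Θ₀, Ṽ_v)` for `β ≥ max β₅ 0` (`bareFloors_of_affinePackage_l2`,
§1), and together with the mean-square chirality-defect bound

* (RBLΔ-L²)    `∫ (kerE_{Q_β}^{lift U}(Wᴿ_v) − kerE_{Q_β}^{lift U}(Ṽ_v) − p' β)² dμ_T(U) ≤ ε/4`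

(lattice support of `v(aβ·)` inside `Q_β` at depth `≥ 2`) the clause-(i) consequences (§2): `Q2_floor_of_affinePackage_l2`
(`ε ≤ Q2_{β,L,aβ}(θv, v)`), `lowerBounds_fst_of_affinePackage_l2`, `floorsTwoPoint_of_affinePackage_l2` (the two-point
conjunct of the registered `UVSeamRec.stub_floorsEngine`, v4-F f523973980851859, any `(G, r, a)`),
`nt_of_affinePackage_l2` (`Theses.BalabanLadder.NT` BY NAME given any clause-(ii) supplier).  §0 `rblAff_l2_of_sup` /
`rblΔ_l2_of_sup` record that the sup forms of (RBL-aff) / (RBLΔ) feed the mean-square forms.  General compact `G`, any `r`; nothing here is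
`SU(2)`-specific (the specialisation to `(SU(2), rF, a/uRec → c₀)` is the sequel `…UVSeamRecFloorsEngineOfAffine`).
Honest status: a proof STRATEGY for (MF) typed as kernel-checked implications; (RBL-aff-L²) (exterior linear-response
law for conditional one-point functions of lattice Yang–Mills — unprinted), (SF-aff), (RBLΔ-L²)'s supplier and clause
(ii) are engine-grade inputs of crux `NT` (barrier `PerturbativeInvisibility`).  Refs: card E
`Cruxes/NT/Ideas/markov-mirror-dirichlet-response.md`; Osterwalder–Seiler 1978 §2; Glimm–Jaffe 1987 §6.1.
-/

set_option autoImplicit false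

noncomputable section

open scoped SchwartzMap
open MeasureTheory Filter Topology
open Literature.MathematicalPhysics.QuantumFieldTheory Literature.MathematicalPhysics.QuantumLattice
open Literature.Probability.LatticeModels
open Summit.QuantumFields.YangMills.Cruxes.OSLegsFromFemtoAndGap.DlrCollarTransfer
open Summit.QuantumFields.YangMills.Cruxes.NT.Reference (continuous_kerE)

namespace Summit.QuantumFields.YangMills.Cruxes.NT.MarkovMirror

section AffinePackage

variable (G : Type) [Group G] [TopologicalSpace G] [IsTopologicalGroup G] [CompactSpace G]
  [MeasurableSpace G] [BorelSpace G] (r : LatticeRep G)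

/-! ## §0 The sup forms of (RBL-aff) and (RBLΔ) feed the mean-square forms -/

/-- **(RBL-aff, sup) ⇒ (RBL-aff-L²)** on every torus: for a bounded continuous `W`, if
`|kerE_Q^ζ(W) − p + (g₀ + ∑_b g_b plane_b ζ)| ≤ √ε/2` for EVERY exterior `ζ` (`0 ≤ ε`), then
`∫ (kerE_Q^{lift U}(W) − p + (g₀ + ∑_b g_b plane_b(lift U)))² dμ_T ≤ ε/4` (`torusE_sq_le_of_abs_le`; continuity from
the Feller property `Reference.continuous_kerE` and `continuous_affinePlane`). [folklore] -/
theorem rblAff_l2_of_sup (β : ℝ) (L : ℕ) (c : Fin 4 → ℤ) (b : ℕ) {W : LGConfig 4 G → ℝ} (hWc : Continuous W)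
    {MW : ℝ} (hMW : ∀ U, |W U| ≤ MW) (S : Finset ((Fin 4 × Fin 4) × (Fin 4 → ℤ))) (g₀ : ℝ)
    (g : (Fin 4 × Fin 4) × (Fin 4 → ℤ) → ℝ) (p : ℝ) {ε : ℝ} (hε : 0 ≤ ε)
    (hRBL : ∀ ζ, |kerE G r β c b ζ W - p + (g₀ + ∑ pl ∈ S, g pl * plane G r pl.1 pl.2 ζ)| ≤ Real.sqrt ε / 2) :
    torusE G r β L (fun V => (kerE G r β c b V W - p + (g₀ + ∑ pl ∈ S, g pl * plane G r pl.1 pl.2 V)) ^ 2) ≤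
      ε / 4 := by
  have hc : Continuous fun V => kerE G r β c b V W - p + (g₀ + ∑ pl ∈ S, g pl * plane G r pl.1 pl.2 V) :=
    ((continuous_kerE G r β c b hWc hMW).sub continuous_const).add (continuous_affinePlane G r S g₀ g)
  have h := torusE_sq_le_of_abs_le G r β L hc hRBL
  rw [div_pow, Real.sq_sqrt hε] at h
  linarith

/-- **(RBLΔ, sup) ⇒ (RBLΔ-L²)** on every torus: if the chirality-defect boundary response satisfies
`|kerE_Q^ζ(Wᴿ) − kerE_Q^ζ(Ṽ) − p'| ≤ √ε/2` for EVERY exterior `ζ` (`0 ≤ ε`; e.g. from (BL6) by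
`defect_response_eventually_le`), then `∫ (kerE_Q^{lift U}(Wᴿ) − kerE_Q^{lift U}(Ṽ) − p')² dμ_T ≤ ε/4` — the
hypothesis (RBLΔ-L²) of `Q2_floor_of_bareFloor_l2` / `Q2_floor_of_affinePackage_l2`. [folklore] -/
theorem rblΔ_l2_of_sup (β : ℝ) (L : ℕ) (c : Fin 4 → ℤ) (b : ℕ) (s : ℝ) (v : 𝓢(EuclideanSpace ℝ (Fin 4), ℝ))
    (p' : ℝ) {ε : ℝ} (hε : 0 ≤ ε)
    (hΔ : ∀ ζ, |kerE G r β c b ζ (fun V => ∑ x ∈ cubeSites c b, v (s • siteToE x) *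
          ∑ q : {q : Fin 4 × Fin 4 // q.1 < q.2}, plane G r q.1 (if q.1.1 = 0 then x - Pi.single 0 1 else x) V) -
        kerE G r β c b ζ (fun V => ∑ y ∈ cubeSites c b, v (s • siteToE y) * dens G r y V) - p'| ≤ Real.sqrt ε / 2) :
    torusE G r β L (fun V => (kerE G r β c b V (fun V => ∑ x ∈ cubeSites c b, v (s • siteToE x) *
        ∑ q : {q : Fin 4 × Fin 4 // q.1 < q.2}, plane G r q.1 (if q.1.1 = 0 then x - Pi.single 0 1 else x) V) -
      kerE G r β c b V (fun V => ∑ y ∈ cubeSites c b, v (s • siteToE y) * dens G r y V) - p') ^ 2) ≤ ε / 4 := by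
  obtain ⟨MW, hMW⟩ := exists_abs_cubeSmear_le G r c b (fun y => v (s • siteToE y))
  obtain ⟨MR, hMR⟩ := exists_abs_reflSmear_le G r (cubeSites c b) (fun x => v (s • siteToE x))
  have hc : Continuous fun V => kerE G r β c b V (fun V => ∑ x ∈ cubeSites c b, v (s • siteToE x) *
        ∑ q : {q : Fin 4 × Fin 4 // q.1 < q.2}, plane G r q.1 (if q.1.1 = 0 then x - Pi.single 0 1 else x) V) -
      kerE G r β c b V (fun V => ∑ y ∈ cubeSites c b, v (s • siteToE y) * dens G r y V) - p' :=
    ((continuous_kerE G r β c b (continuous_reflSmear G r _ _) hMR).sub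
      (continuous_kerE G r β c b (continuous_cubeSmear G r c b _) hMW)).sub continuous_const
  have h := torusE_sq_le_of_abs_le G r β L hc hΔ
  rw [div_pow, Real.sq_sqrt hε] at h
  linarith

/-! ## §1 {RBL-aff-L², SF-aff} along a unit map ⇒ the bare mirror floor (MF) -/

/-- **The bare mirror floors from the affine package, measure-typical form.**  A unit map `a > 0`, ONE test
function `v`, `ε > 0`; for `β ≥ β₅`: a cube `Q_β = (c β, b β)` at times `≥ 1` of physical size
`(|c β j| + b β + 3)·aβ ≤ Λ₅`; a finite plaquette family `S β` based in `[c β − 1, c β + b β]`, coefficients `g β`,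
constants `g₀ β`, `p β`; and on every torus `2L+1` with `Λ₅ ≤ aβ·L`:
(RBL-aff-L²) `torusE[(kerE_{Q_β}(Ṽ) − p β + (g₀ β + ∑_{b∈S β} g β b · plane_b))²] ≤ ε/4` and
(SF-aff) `4ε ≤ ∑_{b,b'∈S β} g β b · g β b' · Cov_T(plane_b∘Θ₀, plane_{b'})`.
Then `9ε/4 ≤ Cov_T(Ṽ∘Θ₀, Ṽ)` for every `β ≥ max β₅ 0` and every torus `Λ₅ ≤ aβ·L`,
`Ṽ = ∑_{y ∈ Q_β} v(aβ·y) dens_y`. [folklore] -/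
theorem bareFloors_of_affinePackage_l2 (a : ℝ → ℝ) (ha₀ : ∀ β, 0 < a β)
    (v : 𝓢(EuclideanSpace ℝ (Fin 4), ℝ)) {ε : ℝ} (hε : 0 < ε) {β₅ Λ₅ : ℝ}
    (c : ℝ → (Fin 4 → ℤ)) (b : ℝ → ℕ) (S : ℝ → Finset ((Fin 4 × Fin 4) × (Fin 4 → ℤ)))
    (g₀ : ℝ → ℝ) (g : ℝ → (Fin 4 × Fin 4) × (Fin 4 → ℤ) → ℝ) (p : ℝ → ℝ)
    (hgeom : ∀ β, β₅ ≤ β → 1 ≤ c β 0 ∧ ∀ j : Fin 4, (|((c β j : ℤ) : ℝ)| + (b β : ℝ) + 3) * a β ≤ Λ₅)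
    (hS : ∀ β, β₅ ≤ β → ∀ pl ∈ S β, ∀ j : Fin 4, c β j - 1 ≤ pl.2 j ∧ pl.2 j ≤ c β j + b β)
    (hRBL2 : ∀ β, β₅ ≤ β → ∀ L : ℕ, Λ₅ ≤ a β * L →
      torusE G r β L (fun V =>
        (kerE G r β (c β) (b β) V (fun V => ∑ y ∈ cubeSites (c β) (b β), v (a β • siteToE y) * dens G r y V) -
          p β + (g₀ β + ∑ pl ∈ S β, g β pl * plane G r pl.1 pl.2 V)) ^ 2) ≤ ε / 4)
    (hSF : ∀ β, β₅ ≤ β → ∀ L : ℕ, Λ₅ ≤ a β * L →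
      4 * ε ≤ ∑ pl ∈ S β, ∑ pl' ∈ S β, g β pl * g β pl' *
        (torusE G r β L (fun V => plane G r pl.1 pl.2 (cfgReflect V) * plane G r pl'.1 pl'.2 V) -
          torusE G r β L (fun V => plane G r pl.1 pl.2 (cfgReflect V)) * torusE G r β L (plane G r pl'.1 pl'.2))) :
    ∀ β : ℝ, max β₅ 0 ≤ β → ∀ L : ℕ, Λ₅ ≤ a β * L →
      9 * ε / 4 ≤ torusE G r β L (fun V =>
          (∑ y ∈ cubeSites (c β) (b β), v (a β • siteToE y) * dens G r y (cfgReflect V)) *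
            ∑ y ∈ cubeSites (c β) (b β), v (a β • siteToE y) * dens G r y V) -
        torusE G r β L (fun V => ∑ y ∈ cubeSites (c β) (b β), v (a β • siteToE y) * dens G r y (cfgReflect V)) *
          torusE G r β L (fun V => ∑ y ∈ cubeSites (c β) (b β), v (a β • siteToE y) * dens G r y V) := by
  intro β hβ L hL
  have hβ₅ : β₅ ≤ β := le_trans (le_max_left _ _) hβ
  have hβ0 : 0 ≤ β := le_trans (le_max_right _ _) hβ
  obtain ⟨hc0, hsize⟩ := hgeom β hβ₅
  obtain ⟨hcL, hc⟩ := torusFit_of_geom (ha₀ β) hsize hL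
  obtain ⟨MW, hMW⟩ := exists_abs_cubeSmear_le G r (c β) (b β) (fun y => v (a β • siteToE y))
  obtain ⟨SW, hWS, hSW⟩ := exists_isCylinder_cubeSmear G r (c β) (b β) (fun y => v (a β • siteToE y))
  have hWc := continuous_cubeSmear G r (c β) (b β) (fun y => v (a β • siteToE y))
  exact mirrorCov_ge_of_affineResponse_l2 G r hβ0 (c β) (b β) L hc0 hcL hc hWc hMW hWS hSW (S β) (hS β hβ₅)
    (g₀ β) (g β) hε (hRBL2 β hβ₅ L hL) (hSF β hβ₅ L hL)

/-- **The bare mirror floors from the affine package, sup form** ((RBL-aff) for every exterior, `√ε/2`; recorded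
for completeness — it implies the measure-typical form on every torus, `rblAff_l2_of_sup`). [folklore] -/
theorem bareFloors_of_affinePackage (a : ℝ → ℝ) (ha₀ : ∀ β, 0 < a β)
    (v : 𝓢(EuclideanSpace ℝ (Fin 4), ℝ)) {ε : ℝ} (hε : 0 < ε) {β₅ Λ₅ : ℝ}
    (c : ℝ → (Fin 4 → ℤ)) (b : ℝ → ℕ) (S : ℝ → Finset ((Fin 4 × Fin 4) × (Fin 4 → ℤ)))
    (g₀ : ℝ → ℝ) (g : ℝ → (Fin 4 × Fin 4) × (Fin 4 → ℤ) → ℝ) (p : ℝ → ℝ)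
    (hgeom : ∀ β, β₅ ≤ β → 1 ≤ c β 0 ∧ ∀ j : Fin 4, (|((c β j : ℤ) : ℝ)| + (b β : ℝ) + 3) * a β ≤ Λ₅)
    (hS : ∀ β, β₅ ≤ β → ∀ pl ∈ S β, ∀ j : Fin 4, c β j - 1 ≤ pl.2 j ∧ pl.2 j ≤ c β j + b β)
    (hRBL : ∀ β, β₅ ≤ β → ∀ ζ,
      |kerE G r β (c β) (b β) ζ (fun V => ∑ y ∈ cubeSites (c β) (b β), v (a β • siteToE y) * dens G r y V) -
          p β + (g₀ β + ∑ pl ∈ S β, g β pl * plane G r pl.1 pl.2 ζ)| ≤ Real.sqrt ε / 2)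
    (hSF : ∀ β, β₅ ≤ β → ∀ L : ℕ, Λ₅ ≤ a β * L →
      4 * ε ≤ ∑ pl ∈ S β, ∑ pl' ∈ S β, g β pl * g β pl' *
        (torusE G r β L (fun V => plane G r pl.1 pl.2 (cfgReflect V) * plane G r pl'.1 pl'.2 V) -
          torusE G r β L (fun V => plane G r pl.1 pl.2 (cfgReflect V)) * torusE G r β L (plane G r pl'.1 pl'.2))) :
    ∀ β : ℝ, max β₅ 0 ≤ β → ∀ L : ℕ, Λ₅ ≤ a β * L →
      9 * ε / 4 ≤ torusE G r β L (fun V =>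
          (∑ y ∈ cubeSites (c β) (b β), v (a β • siteToE y) * dens G r y (cfgReflect V)) *
            ∑ y ∈ cubeSites (c β) (b β), v (a β • siteToE y) * dens G r y V) -
        torusE G r β L (fun V => ∑ y ∈ cubeSites (c β) (b β), v (a β • siteToE y) * dens G r y (cfgReflect V)) *
          torusE G r β L (fun V => ∑ y ∈ cubeSites (c β) (b β), v (a β • siteToE y) * dens G r y V) := by
  refine bareFloors_of_affinePackage_l2 G r a ha₀ v hε c b S g₀ g p hgeom hS (fun β hβ L _ => ?_) hSF
  obtain ⟨MW, hMW⟩ := exists_abs_cubeSmear_le G r (c β) (b β) (fun y => v (a β • siteToE y))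
  exact rblAff_l2_of_sup G r β L (c β) (b β) (continuous_cubeSmear G r (c β) (b β) _) hMW (S β) (g₀ β) (g β) (p β)
    hε.le (hRBL β hβ)

/-! ## §2 Clause (i) and its packagings from {RBL-aff-L², SF-aff, RBLΔ-L²} -/

/-- **`Q2(θv, v) ≥ ε` for all large couplings and tori from the affine package and the mean-square defect bound**
(the lattice support of `v(aβ·)` inside `Q_β` at depth `≥ 2`; (RBLΔ-L²) `≤ ε/4` on every torus `aβ·L ≥ Λ₅`):
`bareFloors_of_affinePackage_l2` feeds `Q2_floor_of_bareFloor_l2`. [folklore] -/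
theorem Q2_floor_of_affinePackage_l2 (a : ℝ → ℝ) (ha₀ : ∀ β, 0 < a β)
    (v : 𝓢(EuclideanSpace ℝ (Fin 4), ℝ)) {ε : ℝ} (hε : 0 < ε) {β₅ Λ₅ : ℝ}
    (c : ℝ → (Fin 4 → ℤ)) (b : ℝ → ℕ) (S : ℝ → Finset ((Fin 4 × Fin 4) × (Fin 4 → ℤ)))
    (g₀ : ℝ → ℝ) (g : ℝ → (Fin 4 × Fin 4) × (Fin 4 → ℤ) → ℝ) (p p' : ℝ → ℝ)
    (hgeom : ∀ β, β₅ ≤ β → 1 ≤ c β 0 ∧ ∀ j : Fin 4, (|((c β j : ℤ) : ℝ)| + (b β : ℝ) + 3) * a β ≤ Λ₅)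
    (hsupp : ∀ β, β₅ ≤ β → ∀ x : Fin 4 → ℤ, v (a β • siteToE x) ≠ 0 →
      x ∈ cubeSites (c β) (b β) ∧ 2 ≤ depth (c β) (b β) x)
    (hS : ∀ β, β₅ ≤ β → ∀ pl ∈ S β, ∀ j : Fin 4, c β j - 1 ≤ pl.2 j ∧ pl.2 j ≤ c β j + b β)
    (hRBL2 : ∀ β, β₅ ≤ β → ∀ L : ℕ, Λ₅ ≤ a β * L →
      torusE G r β L (fun V =>
        (kerE G r β (c β) (b β) V (fun V => ∑ y ∈ cubeSites (c β) (b β), v (a β • siteToE y) * dens G r y V) -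
          p β + (g₀ β + ∑ pl ∈ S β, g β pl * plane G r pl.1 pl.2 V)) ^ 2) ≤ ε / 4)
    (hSF : ∀ β, β₅ ≤ β → ∀ L : ℕ, Λ₅ ≤ a β * L →
      4 * ε ≤ ∑ pl ∈ S β, ∑ pl' ∈ S β, g β pl * g β pl' *
        (torusE G r β L (fun V => plane G r pl.1 pl.2 (cfgReflect V) * plane G r pl'.1 pl'.2 V) -
          torusE G r β L (fun V => plane G r pl.1 pl.2 (cfgReflect V)) * torusE G r β L (plane G r pl'.1 pl'.2)))
    (hΔ2 : ∀ β, β₅ ≤ β → ∀ L : ℕ, Λ₅ ≤ a β * L →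
      torusE G r β L (fun V => (kerE G r β (c β) (b β) V (fun V => ∑ x ∈ cubeSites (c β) (b β),
          v (a β • siteToE x) * ∑ q : {q : Fin 4 × Fin 4 // q.1 < q.2},
            plane G r q.1 (if q.1.1 = 0 then x - Pi.single 0 1 else x) V) -
        kerE G r β (c β) (b β) V (fun V => ∑ y ∈ cubeSites (c β) (b β), v (a β • siteToE y) * dens G r y V) -
        p' β) ^ 2) ≤ ε / 4) :
    ∀ β : ℝ, max β₅ 0 ≤ β → ∀ L : ℕ, Λ₅ ≤ a β * L → ε ≤ Q2 G r β L (a β) (thetaTest 4 v) v := by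
  have hMF := bareFloors_of_affinePackage_l2 G r a ha₀ v hε c b S g₀ g p hgeom hS hRBL2 hSF
  intro β hβ L hL
  have h := Q2_floor_of_bareFloor_l2 G r a ha₀ v hε (β₅ := max β₅ 0) (Λ₅ := Λ₅) c b p'
    (fun β hβ => hgeom β (le_trans (le_max_left _ _) hβ))
    (fun β hβ => hsupp β (le_trans (le_max_left _ _) hβ))
    (fun β hβ => hΔ2 β (le_trans (le_max_left _ _) hβ)) hMF β ?_ L hL
  · exact h
  · exact max_le hβ (le_trans (le_max_right _ _) hβ)

/-- **Clause (i) of `LowerBounds G r a` from {RBL-aff-L², SF-aff, RBLΔ-L²}.** [folklore] -/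
theorem lowerBounds_fst_of_affinePackage_l2 (a : ℝ → ℝ) (ha₀ : ∀ β, 0 < a β)
    (v : 𝓢(EuclideanSpace ℝ (Fin 4), ℝ)) (hv : tsupport (v : EuclideanSpace ℝ (Fin 4) → ℝ) ⊆ {y | 0 < y 0})
    {ε : ℝ} (hε : 0 < ε) {β₅ Λ₅ : ℝ}
    (c : ℝ → (Fin 4 → ℤ)) (b : ℝ → ℕ) (S : ℝ → Finset ((Fin 4 × Fin 4) × (Fin 4 → ℤ)))
    (g₀ : ℝ → ℝ) (g : ℝ → (Fin 4 × Fin 4) × (Fin 4 → ℤ) → ℝ) (p p' : ℝ → ℝ)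
    (hgeom : ∀ β, β₅ ≤ β → 1 ≤ c β 0 ∧ ∀ j : Fin 4, (|((c β j : ℤ) : ℝ)| + (b β : ℝ) + 3) * a β ≤ Λ₅)
    (hsupp : ∀ β, β₅ ≤ β → ∀ x : Fin 4 → ℤ, v (a β • siteToE x) ≠ 0 →
      x ∈ cubeSites (c β) (b β) ∧ 2 ≤ depth (c β) (b β) x)
    (hS : ∀ β, β₅ ≤ β → ∀ pl ∈ S β, ∀ j : Fin 4, c β j - 1 ≤ pl.2 j ∧ pl.2 j ≤ c β j + b β)
    (hRBL2 : ∀ β, β₅ ≤ β → ∀ L : ℕ, Λ₅ ≤ a β * L →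
      torusE G r β L (fun V =>
        (kerE G r β (c β) (b β) V (fun V => ∑ y ∈ cubeSites (c β) (b β), v (a β • siteToE y) * dens G r y V) -
          p β + (g₀ β + ∑ pl ∈ S β, g β pl * plane G r pl.1 pl.2 V)) ^ 2) ≤ ε / 4)
    (hSF : ∀ β, β₅ ≤ β → ∀ L : ℕ, Λ₅ ≤ a β * L →
      4 * ε ≤ ∑ pl ∈ S β, ∑ pl' ∈ S β, g β pl * g β pl' *
        (torusE G r β L (fun V => plane G r pl.1 pl.2 (cfgReflect V) * plane G r pl'.1 pl'.2 V) -
          torusE G r β L (fun V => plane G r pl.1 pl.2 (cfgReflect V)) * torusE G r β L (plane G r pl'.1 pl'.2)))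
    (hΔ2 : ∀ β, β₅ ≤ β → ∀ L : ℕ, Λ₅ ≤ a β * L →
      torusE G r β L (fun V => (kerE G r β (c β) (b β) V (fun V => ∑ x ∈ cubeSites (c β) (b β),
          v (a β • siteToE x) * ∑ q : {q : Fin 4 × Fin 4 // q.1 < q.2},
            plane G r q.1 (if q.1.1 = 0 then x - Pi.single 0 1 else x) V) -
        kerE G r β (c β) (b β) V (fun V => ∑ y ∈ cubeSites (c β) (b β), v (a β • siteToE y) * dens G r y V) -
        p' β) ^ 2) ≤ ε / 4) :
    ∃ (v : 𝓢(EuclideanSpace ℝ (Fin 4), ℝ)) (ε β₅ Λ₅ : ℝ),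
      tsupport (v : EuclideanSpace ℝ (Fin 4) → ℝ) ⊆ {y : EuclideanSpace ℝ (Fin 4) | 0 < y 0} ∧ 0 < ε ∧
      ∀ β : ℝ, β₅ ≤ β → ∀ L : ℕ, Λ₅ ≤ a β * L → ε ≤ Q2 G r β L (a β) (thetaTest 4 v) v :=
  ⟨v, ε, max β₅ 0, Λ₅, hv, hε,
    Q2_floor_of_affinePackage_l2 G r a ha₀ v hε c b S g₀ g p p' hgeom hsupp hS hRBL2 hSF hΔ2⟩

/-- **The two-point conjunct of `UVSeamRec.stub_floorsEngine` (v4-F) from {RBL-aff-L², SF-aff, RBLΔ-L²}** (compact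
support of the witness recorded; any `(G, r, a)` — at `(SU(2), rF, a ≍ c₀·uRec)` it is the registered conjunct).
[folklore] -/
theorem floorsTwoPoint_of_affinePackage_l2 (a : ℝ → ℝ) (ha₀ : ∀ β, 0 < a β)
    (v : 𝓢(EuclideanSpace ℝ (Fin 4), ℝ)) (hvK : HasCompactSupport (v : EuclideanSpace ℝ (Fin 4) → ℝ))
    (hv : tsupport (v : EuclideanSpace ℝ (Fin 4) → ℝ) ⊆ {y | 0 < y 0})
    {ε : ℝ} (hε : 0 < ε) {β₅ Λ₅ : ℝ}
    (c : ℝ → (Fin 4 → ℤ)) (b : ℝ → ℕ) (S : ℝ → Finset ((Fin 4 × Fin 4) × (Fin 4 → ℤ)))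
    (g₀ : ℝ → ℝ) (g : ℝ → (Fin 4 × Fin 4) × (Fin 4 → ℤ) → ℝ) (p p' : ℝ → ℝ)
    (hgeom : ∀ β, β₅ ≤ β → 1 ≤ c β 0 ∧ ∀ j : Fin 4, (|((c β j : ℤ) : ℝ)| + (b β : ℝ) + 3) * a β ≤ Λ₅)
    (hsupp : ∀ β, β₅ ≤ β → ∀ x : Fin 4 → ℤ, v (a β • siteToE x) ≠ 0 →
      x ∈ cubeSites (c β) (b β) ∧ 2 ≤ depth (c β) (b β) x)
    (hS : ∀ β, β₅ ≤ β → ∀ pl ∈ S β, ∀ j : Fin 4, c β j - 1 ≤ pl.2 j ∧ pl.2 j ≤ c β j + b β)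
    (hRBL2 : ∀ β, β₅ ≤ β → ∀ L : ℕ, Λ₅ ≤ a β * L →
      torusE G r β L (fun V =>
        (kerE G r β (c β) (b β) V (fun V => ∑ y ∈ cubeSites (c β) (b β), v (a β • siteToE y) * dens G r y V) -
          p β + (g₀ β + ∑ pl ∈ S β, g β pl * plane G r pl.1 pl.2 V)) ^ 2) ≤ ε / 4)
    (hSF : ∀ β, β₅ ≤ β → ∀ L : ℕ, Λ₅ ≤ a β * L →
      4 * ε ≤ ∑ pl ∈ S β, ∑ pl' ∈ S β, g β pl * g β pl' *
        (torusE G r β L (fun V => plane G r pl.1 pl.2 (cfgReflect V) * plane G r pl'.1 pl'.2 V) -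
          torusE G r β L (fun V => plane G r pl.1 pl.2 (cfgReflect V)) * torusE G r β L (plane G r pl'.1 pl'.2)))
    (hΔ2 : ∀ β, β₅ ≤ β → ∀ L : ℕ, Λ₅ ≤ a β * L →
      torusE G r β L (fun V => (kerE G r β (c β) (b β) V (fun V => ∑ x ∈ cubeSites (c β) (b β),
          v (a β • siteToE x) * ∑ q : {q : Fin 4 × Fin 4 // q.1 < q.2},
            plane G r q.1 (if q.1.1 = 0 then x - Pi.single 0 1 else x) V) -
        kerE G r β (c β) (b β) V (fun V => ∑ y ∈ cubeSites (c β) (b β), v (a β • siteToE y) * dens G r y V) -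
        p' β) ^ 2) ≤ ε / 4) :
    ∃ (v : 𝓢(EuclideanSpace ℝ (Fin 4), ℝ)) (ε β₅ Λ₅ : ℝ),
      HasCompactSupport (v : EuclideanSpace ℝ (Fin 4) → ℝ) ∧
      tsupport (v : EuclideanSpace ℝ (Fin 4) → ℝ) ⊆ {y : EuclideanSpace ℝ (Fin 4) | 0 < y 0} ∧ 0 < ε ∧
      ∀ β : ℝ, β₅ ≤ β → ∀ L : ℕ, Λ₅ ≤ a β * L → ε ≤ Q2 G r β L (a β) (thetaTest 4 v) v :=
  ⟨v, ε, max β₅ 0, Λ₅, hvK, hv, hε,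
    Q2_floor_of_affinePackage_l2 G r a ha₀ v hε c b S g₀ g p p' hgeom hsupp hS hRBL2 hSF hΔ2⟩

end AffinePackage

/-- **`NT` BY NAME from {RBL-aff-L², SF-aff, RBLΔ-L²} and any clause-(ii) supplier** (every compact simple `G`, Borel
σ-algebra; via `lowerBounds_fst_of_affinePackage_l2`). [folklore] -/
theorem nt_of_affinePackage_l2
    (h : ∀ (G : Type) [Group G] [TopologicalSpace G] [IsTopologicalGroup G] [CompactSpace G],
      IsCompactSimpleLieGroup G → letI : MeasurableSpace G := borel G; haveI : BorelSpace G := ⟨rfl⟩;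
      ∃ (r : LatticeRep G) (a : ℝ → ℝ), (∀ β, 0 < a β) ∧ Tendsto a atTop (𝓝 0) ∧
        (∃ (v : 𝓢(EuclideanSpace ℝ (Fin 4), ℝ)) (ε β₅ Λ₅ : ℝ) (c : ℝ → (Fin 4 → ℤ)) (b : ℝ → ℕ)
          (S : ℝ → Finset ((Fin 4 × Fin 4) × (Fin 4 → ℤ))) (g₀ : ℝ → ℝ)
          (g : ℝ → (Fin 4 × Fin 4) × (Fin 4 → ℤ) → ℝ) (p p' : ℝ → ℝ),
          tsupport (v : EuclideanSpace ℝ (Fin 4) → ℝ) ⊆ {y | 0 < y 0} ∧ 0 < ε ∧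
          (∀ β, β₅ ≤ β → 1 ≤ c β 0 ∧ ∀ j : Fin 4, (|((c β j : ℤ) : ℝ)| + (b β : ℝ) + 3) * a β ≤ Λ₅) ∧
          (∀ β, β₅ ≤ β → ∀ x : Fin 4 → ℤ, v (a β • siteToE x) ≠ 0 →
            x ∈ cubeSites (c β) (b β) ∧ 2 ≤ depth (c β) (b β) x) ∧
          (∀ β, β₅ ≤ β → ∀ pl ∈ S β, ∀ j : Fin 4, c β j - 1 ≤ pl.2 j ∧ pl.2 j ≤ c β j + b β) ∧
          (∀ β, β₅ ≤ β → ∀ L : ℕ, Λ₅ ≤ a β * L →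
            torusE G r β L (fun V =>
              (kerE G r β (c β) (b β) V (fun V => ∑ y ∈ cubeSites (c β) (b β), v (a β • siteToE y) * dens G r y V) -
                p β + (g₀ β + ∑ pl ∈ S β, g β pl * plane G r pl.1 pl.2 V)) ^ 2) ≤ ε / 4) ∧
          (∀ β, β₅ ≤ β → ∀ L : ℕ, Λ₅ ≤ a β * L →
            4 * ε ≤ ∑ pl ∈ S β, ∑ pl' ∈ S β, g β pl * g β pl' *
              (torusE G r β L (fun V => plane G r pl.1 pl.2 (cfgReflect V) * plane G r pl'.1 pl'.2 V) -
                torusE G r β L (fun V => plane G r pl.1 pl.2 (cfgReflect V)) *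
                  torusE G r β L (plane G r pl'.1 pl'.2))) ∧
          (∀ β, β₅ ≤ β → ∀ L : ℕ, Λ₅ ≤ a β * L →
            torusE G r β L (fun V => (kerE G r β (c β) (b β) V (fun V => ∑ x ∈ cubeSites (c β) (b β),
                v (a β • siteToE x) * ∑ q : {q : Fin 4 × Fin 4 // q.1 < q.2},
                  plane G r q.1 (if q.1.1 = 0 then x - Pi.single 0 1 else x) V) -
              kerE G r β (c β) (b β) V (fun V => ∑ y ∈ cubeSites (c β) (b β), v (a β • siteToE y) * dens G r y V) -
              p' β) ^ 2) ≤ ε / 4)) ∧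
        (∃ (f g h : 𝓢(EuclideanSpace ℝ (Fin 4), ℝ)) (ε β₅ Λ₅ : ℝ), Disjoint (tsupport f) (tsupport g) ∧
          Disjoint (tsupport g) (tsupport h) ∧ Disjoint (tsupport f) (tsupport h) ∧ 0 < ε ∧
          ∀ β : ℝ, β₅ ≤ β → ∀ L : ℕ, Λ₅ ≤ a β * L → ε ≤ |Q3 G r β L (a β) f g h|)) :
    Summit.QuantumFields.YangMills.Theses.BalabanLadder.NT := by
  intro G _ _ _ _ hG
  letI : MeasurableSpace G := borel G
  haveI : BorelSpace G := ⟨rfl⟩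
  obtain ⟨r, a, ha₀, ha, ⟨v, ε, β₅, Λ₅, c, b, S, g₀, g, p, p', hv, hε, hgeom, hsupp, hS, hRBL2, hSF, hΔ2⟩, h3⟩ :=
    h G hG
  exact ⟨r, a, ha₀, ha,
    lowerBounds_fst_of_affinePackage_l2 G r a ha₀ v hv hε c b S g₀ g p p' hgeom hsupp hS hRBL2 hSF hΔ2, h3⟩

end Summit.QuantumFields.YangMills.Cruxes.NT.MarkovMirror

end
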